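import Summits.BirchSwinnertonDyer.BirchSwinnertonDyer.Theorems.MordellShaFreeCutPoitouTateImQuad
import Literature.NumberTheory.EllipticCurves.BDPAnticyclotomicPAdicLFunctionUpTo

set_option linter.dupNamespace false
set_option autoImplicit false

/-! # Route `MordellShaFreeCut` (rung S2b) — the BDP triple of crux B (stmt-BirchSwinnertonDyer-19160)
# UP TO NONZERO CONSTANTS: (LB-exist♯)₃ / (LB-wan♯)₃ / (LB-bdp♯)₃ NAMED, and the plumbing, the crux-B
# census and the corank-currency census PORTED to them (Mordell twin of
# `CongruentShaFreeCutTwoAdicBDPTripleUpTo.lean`)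

Cell `bsd-cn100`, prover seat `bsd-cn100-s2b-c3` (g4), executing the plan seat's decision (iii) kernel
follow-up (2) (plan g13, STATUS 2026-08-26T13:33:52Z; memo
`HOME/bsd-cn100-plan/routes-g13/DESIGN-LBexist-normalisation-g13.md`; planner sketch
`routes-g13/bc/BDPTripleUpTo_sketch_p3.lean` — the three bodies below are that sketch's, VERBATIM).
Supports, does not close, stmt-BirchSwinnertonDyer-19160 (and serves the residual 19159). HONEST
FRAMING: three OPEN statements are NAMED (`@[conjecture] def`, nothing asserted) and CONDITIONAL theorems
are proved over them; nothing here proves crux A, crux B, the leaf `rankOne_threeConverse_mordellCurve`,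
Sylvester's conjecture or any case of BSD. PARTITION: none — RANK axis.

## Why (statement hygiene of the line of record `three-adic-bdp-triple` v5c)

The v5/v5b/v5c statements `MordellShaFreeCutThreeAdicBDPTriple.{ThreeAdicBDPElementExists,
ThreeAdicWanDivisibility, ThreeAdicBDPValueAtOne}` (p439508) posit Castella's EXACT display
`IsBDPLFunction` (Castella 2018 Thm. 3.1) for `𝓛 ∈ R₀⟦T⟧` at `p = 3`. The printed constant ledger behind
that display (Castella–Hsieh 2018 Prop. 3.4 / 3.6) consists of `p`-units for odd `p ∤ c D_K` — so at
`p = 3` split in the Heegner field the ♯-form is only a HEDGE (plan g13: «at 3 split every CH constant is a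
3-UNIT, so S2b gets ♯ only as a hedge»); it is landed so that both routes carry the same
normalisation-INVARIANT currency: `IsBDPLFunction …` ↦ `IsBDPLFunctionUpTo C …` with `C ∈ ℂ₃, C ≠ 0`
quantified (∃ in (LB-exist♯), ∀ in (LB-wan♯)/(LB-bdp♯)), and `u ∈ R₀ˣ` in (LB-bdp) ↦ `u ∈ ℂ₃, u ≠ 0`.
(LB-exist) ⟹ (LB-exist♯) (`threeAdicBDPElementExistsUpTo_of_exact`); (LB-wan)/(LB-bdp) do NOT cheaply
dominate their ♯-forms, so the ♯ line is PARALLEL to v5c, not a re-cut.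

## Contents

§1 the three ♯ statements; §2 sanity; §3 the rank-currency PLUMBING
`heegnerNonTorsion_of_linkA_of_bdpTripleUpTo` (port of the registered plumbing stub p439508: the proof never
unfolds the interpolation property, so it ports verbatim — `⟨…, C, L, hΩ, hC, hL⟩`, `⟨u, hu0, hu⟩`); §4 the
crux-B census `cruxB_of_bdpTripleUpTo_of_poitouTate[_imaginaryQuadratic]` (ports of p439803 / p448851, Link A
from Poitou–Tate at the imaginary quadratic fields,
`MordellShaFreeCutPoitouTateImQuad.threeAdicControlOfRankOne_of_poitouTate_imaginaryQuadratic`). The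
corank-currency plumbing and crux A (ports of p440480 / p448851) are the sibling
`Theorems/MordellShaFreeCutBDPTripleUpToCensus.lean` (400-line rule).

References: [Castella2018] Thm. 2.3, 3.1, 3.4; [CastellaHsieh2018] §3.3, Prop. 3.4, Def. 3.5, Prop. 3.6;
[CastellaGrossiLeeSkinner2022] Thm. 4.2.2, §5.1–5.2, Thm. 5.1.3; [BertoliniDarmonPrasanna2013] Thm. 5.13;
[SilvermanAEC2009] IV.6.4, VII.2.2; [MilneADT2006] I.4.10(b). -/

noncomputable section

open scoped Classical

namespace Summit.BirchSwinnertonDyer.BirchSwinnertonDyer.Theorems.MordellShaFreeCutThreeAdicBDPTripleUpTo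

open PowerSeries WeierstrassCurve NumberField IsDedekindDomain Field Literature.NumberTheory.EllipticCurves
  Literature.NumberTheory.EllipticCurves.ModularForms Literature.NumberTheory.QuadraticFields
  Literature.NumberTheory.EllipticCurves.Castella2018
open Literature.NumberTheory.GaloisRepresentations Literature.NumberTheory.GaloisCohomology
open Summit.BirchSwinnertonDyer.BirchSwinnertonDyer.Theses.MordellShaFreeCut
open Summit.BirchSwinnertonDyer.BirchSwinnertonDyer.Theorems.MordellShaFreeCutThreeAdicLinks
open Summit.BirchSwinnertonDyer.BirchSwinnertonDyer.Theorems.MordellShaFreeCutThreeAdicBDPTriple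
  (ThreeAdicBDPElementExists ThreeAdicWanDivisibility ThreeAdicBDPValueAtOne)
open Summit.BirchSwinnertonDyer.BirchSwinnertonDyer.Theorems.MordellShaFreeCutPoitouTateImQuad
  (threeAdicControlOfRankOne_of_poitouTate_imaginaryQuadratic)

/-! ## §1 The three BDP-currency statements UP TO NONZERO CONSTANTS (OPEN; named, nothing asserted;
bodies verbatim from the planner sketch `BDPTripleUpTo_sketch_p3.lean`) -/

/-- **(LB-exist♯)₃ a `3`-adic anticyclotomic BDP element for a `j = 0` curve over a Heegner field with `3`
split, UP TO A NONZERO CONSTANT**: with the data of `ThreeAdicBDPElementExists` (`W` globally minimal with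
`j = 0`, `N = N(W)`, `Dt`, `K` imaginary quadratic with the Heegner hypothesis for `N` and `3 = v v̄` split,
`κ` anticyclotomic with topological generator `γ`) there are an embedding datum `ι'` inducing `v`, CM
periods `Ω_K ≠ 0`, `Ω_p ∈ R₀ˣ`, a constant `C ∈ ℂ₃, C ≠ 0` and `𝓛 ∈ R₀⟦T⟧` with
`IsBDPLFunctionUpTo C ι' v κ γ Dt.f Ω_K Ω_p 𝓛`. A CONSTRUCTION (open at the additive prime `3`); implied by
the exact (LB-exist) (`threeAdicBDPElementExistsUpTo_of_exact`).
[cite: Castella2018, Thm. 3.1 (shape; `p ≥ 5`, `p ∥ N` there)]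
[cite: CastellaHsieh2018, Def. 3.5 and Prop. 3.6 (shape; `p ∤ N` there; the constant `u`)] -/
@[conjecture] def ThreeAdicBDPElementExistsUpTo : Prop :=
  ∀ (W : WeierstrassCurve ℚ) [W.IsElliptic] [W.IsGloballyMinimal], W.j = 0 →
    ∀ (K : Type) [Field K] [NumberField K] (N : ℕ) [NeZero N]
      (Dt : ModularParametrizationData W N)
      (v : HeightOneSpectrum (𝓞 K)) (κ : ZpExtension K 3) (γ : absoluteGaloisGroup K)
      [Fact (κ.IsTopGenerator γ)],
    W.conductorNorm ℤ = N → IsImaginaryQuadratic K →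
    SatisfiesHeegnerHypothesis N K → ((Ideal.span {(3 : ℤ)}).primesOver (𝓞 K)).ncard = 2 →
    ((3 : ℕ) : 𝓞 K) ∈ v.asIdeal → κ.IsAnticyclotomic →
    ∃ ι' : PadicAlgCl 3 ≃+* ℂ,
      (∀ (w : InfinitePlace K) (k : 𝓞 K), k ∈ v.asIdeal ↔ ‖ι'.symm (w.embedding (k : K))‖ < 1) ∧
      ∃ (ΩK : ℂ) (Ωp : (unrIntegers 3)ˣ) (C : ℂ_[3]) (L : UnrSeries 3),
        ΩK ≠ 0 ∧ C ≠ 0 ∧ IsBDPLFunctionUpTo C ι' v κ γ Dt.f ΩK ((Ωp : unrIntegers 3) : ℂ_[3]) L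


/-- **(LB-wan♯)₃ the `p`-converse divisibility of the `3`-adic anticyclotomic main conjecture for the
`j = 0` curve `W`, for EVERY BDP element UP TO A NONZERO CONSTANT**: with the data of
`ThreeAdicWanDivisibility`, for every `(ι', Ω_K, Ω_p, C, 𝓛)` with `Ω_K ≠ 0`, `C ≠ 0`, `IsBDPLFunctionUpTo C …`
and every structure map `j : ℤ₃ → R₀`: `3^k · j_*(char_Λ 𝔛) ⊆ (𝓛)` for some `k`. OPEN at the additive
prime `3` (in print: `p ∤ 2N`, and only the OTHER direction in CGLS 2022).
[cite: CastellaGrossiLeeSkinner2022, Thm. 4.2.2 and §5.3 (shape of the OTHER divisibility; nothing asserted)]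
[cite: Castella2018, Thm. 3.4 (shape; nothing asserted)] -/
@[conjecture] def ThreeAdicWanDivisibilityUpTo : Prop :=
  ∀ (W : WeierstrassCurve ℚ) [W.IsElliptic] [W.IsGloballyMinimal], W.j = 0 →
    ∀ (ι' : PadicAlgCl 3 ≃+* ℂ) (K : Type) [Field K] [NumberField K] (N : ℕ) [NeZero N]
      (Dt : ModularParametrizationData W N)
      (v vbar : HeightOneSpectrum (𝓞 K)) (κ : ZpExtension K 3) (γ : absoluteGaloisGroup K)
      [Fact (κ.IsTopGenerator γ)],
    W.conductorNorm ℤ = N → IsImaginaryQuadratic K →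
    SatisfiesHeegnerHypothesis N K → ((Ideal.span {(3 : ℤ)}).primesOver (𝓞 K)).ncard = 2 →
    (∀ (w : InfinitePlace K) (k : 𝓞 K), k ∈ v.asIdeal ↔ ‖ι'.symm (w.embedding (k : K))‖ < 1) →
    ((3 : ℕ) : 𝓞 K) ∈ vbar.asIdeal → vbar ≠ v → κ.IsAnticyclotomic →
    ∀ (ΩK : ℂ) (Ωp : (unrIntegers 3)ˣ) (C : ℂ_[3]) (L : UnrSeries 3),
      ΩK ≠ 0 → C ≠ 0 → IsBDPLFunctionUpTo C ι' v κ γ Dt.f ΩK ((Ωp : unrIntegers 3) : ℂ_[3]) L →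
    ∀ (j : ℤ_[3] →+* unrIntegers 3),
      (∀ x : ℤ_[3], ((j x : unrIntegers 3) : ℂ_[3]) = algebraMap ℚ_[3] ℂ_[3] (x : ℚ_[3])) →
      ∃ k : ℕ, ∀ F ∈ AcSelmer.XAc.charIdeal (W.baseChange K) 3 κ vbar ∅ γ,
        PowerSeries.C ((3 : unrIntegers 3) ^ k) * PowerSeries.map j F ∈ Ideal.span {L}


/-- **(LB-bdp♯)₃ the BDP formula at the trivial character for the `j = 0` curve `W` at the additive prime
`3`, UP TO A NONZERO CONSTANT of `ℂ₃`, for EVERY BDP element up to a constant**: with the data of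
`ThreeAdicBDPValueAtOne` (`H`, `w`, `e` inducing `v`, `P` THE Heegner point), for every
`(ι', Ω_K, Ω_p, C, 𝓛)` with `Ω_K ≠ 0`, `C ≠ 0`, `IsBDPLFunctionUpTo C …`:
`𝓛(𝟙) = u · c⁻² · (1 − a₃·3⁻¹ + [3 ∤ N]·3⁻¹)² · (log_ω P)²` for some `u ∈ ℂ₃, u ≠ 0`. OPEN at `p = 3 ∣ N`
(in print: `p ∤ 2N`). [cite: CastellaGrossiLeeSkinner2022, Thm. 5.1.3 (shape; `p ∤ 2N` there; nothing asserted)]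
[cite: BertoliniDarmonPrasanna2013, Thm. 5.13 (shape; nothing asserted)] -/
@[conjecture] def ThreeAdicBDPValueAtOneUpTo : Prop :=
  ∀ (W : WeierstrassCurve ℚ) [W.IsElliptic] [W.IsGloballyMinimal], W.j = 0 →
    ∀ (ι' : PadicAlgCl 3 ≃+* ℂ) (K : Type) [Field K] [NumberField K] (N : ℕ) [NeZero N]
      (Dt : ModularParametrizationData W N)
      (H : HeegnerDatum N (NumberField.discr K)) (w : InfinitePlace K) (e : K →+* ℚ_[3])
      (v : HeightOneSpectrum (𝓞 K)) (κ : ZpExtension K 3) (γ : absoluteGaloisGroup K)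
      [Fact (κ.IsTopGenerator γ)] (P : (W.baseChange K).toAffine.Point),
    W.conductorNorm ℤ = N → IsImaginaryQuadratic K →
    SatisfiesHeegnerHypothesis N K → ((Ideal.span {(3 : ℤ)}).primesOver (𝓞 K)).ncard = 2 →
    ((3 : ℕ) : 𝓞 K) ∈ v.asIdeal →
    (∀ (w' : InfinitePlace K) (k : 𝓞 K), k ∈ v.asIdeal ↔ ‖ι'.symm (w'.embedding (k : K))‖ < 1) →
    κ.IsAnticyclotomic →
    WeierstrassCurve.Affine.Point.map w.embedding.toRatAlgHom P = heegnerPointComplex Dt H →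
    (∀ k : 𝓞 K, k ∈ v.asIdeal ↔ ‖e (k : K)‖ < 1) →
    ∀ (ΩK : ℂ) (Ωp : (unrIntegers 3)ˣ) (C : ℂ_[3]) (L : UnrSeries 3),
      ΩK ≠ 0 → C ≠ 0 → IsBDPLFunctionUpTo C ι' v κ γ Dt.f ΩK ((Ωp : unrIntegers 3) : ℂ_[3]) L →
      ∃ u : ℂ_[3], u ≠ 0 ∧ L.HasValueAt 0
        (u * algebraMap ℚ_[3] ℂ_[3] (((Dt.c : ℚ_[3])⁻¹) ^ 2 *
            (1 - (W.LFunction 3 : ℚ_[3]) * (3 : ℚ_[3])⁻¹ +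
              (if (3 : ℕ) ∣ N then 0 else (3 : ℚ_[3])⁻¹)) ^ 2 *
            (padicLogOmega W 3 e P) ^ 2))


/-! ## §2 Sanity: the exact (LB-exist) implies (LB-exist♯) (with `C = 1`) -/

/-- **(LB-exist) ⟹ (LB-exist♯)**: an exact BDP element is an element up to the constant `C = 1 ≠ 0`
(`IsBDPLFunction.upTo_one`). So the ♯ existence statement is WEAKER than the registered one.
[cite: Castella2018, Thm. 3.1] -/
theorem threeAdicBDPElementExistsUpTo_of_exact (h : ThreeAdicBDPElementExists) :
    ThreeAdicBDPElementExistsUpTo := by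
  intro W _ _ hj K _ _ N _ Dt v κ γ _ hN hK hH h3 hv hκ
  obtain ⟨ι', hι', ΩK, Ωp, L, hΩ, hL⟩ := h W hj K N Dt v κ γ hN hK hH h3 hv hκ
  exact ⟨ι', hι', ΩK, Ωp, 1, L, hΩ, one_ne_zero, hL.upTo_one⟩

/-! ## §3 The rank-currency plumbing, ported (Link A + the ♯ triple ⟹ Heegner points are non-torsion) -/

/-- **`heegnerNonTorsion_of_linkA_of_bdpTripleUpTo`** — the registered plumbing
`MordellShaFreeCutThreeAdicBDPTriple.stub_heegnerNonTorsion_of_linkA_of_bdpTriple` (p439508) with the BDP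
triple replaced by its ♯-form: Kato (`hKato`), Link A (`hA`: a generator `F` of `char_Λ 𝔛` with
`F(0) ≠ 0`), (LB-exist♯) (`hE`: `ι'`, `C ≠ 0`, `𝓛`), (LB-wan♯) (`hWan`, along `toUnr : ℤ₃ → R₀`:
`G · 𝓛 = 3^k · toUnr_* F` ⟹ `𝓛(0) ≠ 0`), (LB-bdp♯) (`hV`: `𝓛(0) = u·c⁻²·(…)²·(log_ω P')²`, `u ∈ ℂ₃`)
give `log_ω P' ≠ 0` for the Galois conjugate `P' = τ_* P` of the Heegner point read through THE infinite
place, hence `P` non-torsion (the logarithm of a torsion point vanishes). The proof is p439508's, token for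
token except for the three hypothesis types and the anonymous constructors — the plumbing never unfolds the
interpolation property, so the constant `C` is carried, not used. CONDITIONAL; credits nothing.
[cite: Castella2018, proof of Thm. 2.3 with Thm. 3.4 (the shape of this step)]
[cite: CastellaGrossiLeeSkinner2022, §5.2 (proof of Thm. 5.2.1)] [cite: SilvermanAEC2009, IV.6.4 and VII.2.2] -/
theorem heegnerNonTorsion_of_linkA_of_bdpTripleUpTo
    (hKato : ∀ (W : WeierstrassCurve ℚ) [W.IsElliptic] (p : ℕ) [Fact p.Prime],
      kato_finite_of_L_one_ne_zero W p)
    (hA : ThreeAdicControlOfRankOne) (hE : ThreeAdicBDPElementExistsUpTo)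
    (hWan : ThreeAdicWanDivisibilityUpTo) (hV : ThreeAdicBDPValueAtOneUpTo) :
    ∀ (W : WeierstrassCurve ℚ) [W.IsElliptic] [W.IsGloballyMinimal], W.j = 0 →
      ∀ (K : Type) [Field K] [NumberField K] (N : ℕ) [NeZero N], W.conductorNorm ℤ = N →
        IsImaginaryQuadratic K → SatisfiesHeegnerHypothesis N K → SatisfiesHeegnerHypothesis 3 K →
          (W.quadraticTwist (NumberField.discr K : ℚ)).entireLFunction 1 ≠ 0 →
            W.mordellWeilRank = 1 → Finite (AddCommGroup.primaryComponent W.sha 3) →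
              ∀ (P : (W.baseChange K).toAffine.Point), IsHeegnerPoint N W K P →
                ¬ IsOfFinAddOrder P := by
  intro W _ _ hj K _ _ N _ hN hK hHN hH3 hL hrank hsha P hP
  -- (0) `3 = v v̄` splits in `K`
  have hsplit : ((Ideal.span {(3 : ℤ)}).primesOver (𝓞 K)).ncard = 2 := by
    simpa using hH3 3 Nat.prime_three (dvd_refl 3)
  -- (1) the rank-one data over `K` (Kato on the twist)
  obtain ⟨hrk, -, hshaK⟩ :=
    AcPConverseLinks.rank_corank_sha_baseChange_of_twist_L_one_ne_zero hKato W 3 hK hL hrank hsha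
  -- (2) the anticyclotomic datum `(κ, γ)`, THE embedding at a degree-one `𝔭 ∋ 3`, `v`, `v̄`
  obtain ⟨κ, γ, 𝔭, hκ, hγ, h𝔭, he, hf⟩ :=
    Summit.BirchSwinnertonDyer.Rank1Residual.X11b.exists_anticyclotomic_generator_degreeOnePrime
      3 K hK hH3
  haveI : Fact (κ.IsTopGenerator γ) := ⟨hγ⟩
  set ι : K →+* ℚ_[3] := Summit.BirchSwinnertonDyer.Rank1Residual.X11b.embAt K 3 𝔭 h𝔭 he hf
    with hιdef
  set v := Summit.BirchSwinnertonDyer.Rank1Residual.X11b.inducedPlace ι with hvdef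
  have hv : ∀ x : 𝓞 K, x ∈ v.asIdeal ↔ ‖ι (x : K)‖ < 1 :=
    Summit.BirchSwinnertonDyer.Rank1Residual.X11b.mem_inducedPlace_iff ι
  have hv3 : ((3 : ℕ) : 𝓞 K) ∈ v.asIdeal :=
    Summit.BirchSwinnertonDyer.Rank1Residual.X11b.natCast_mem_inducedPlace ι
  obtain ⟨vbar, hvbar, hne⟩ :=
    Summit.BirchSwinnertonDyer.Rank1Residual.X11b.exists_other_prime hH3 v hv3
  -- (3) Link A at this datum: a generator `F` of `char_Λ 𝔛` with `F(0) ≠ 0`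
  obtain ⟨m, -, F, hF, hF0, -⟩ := hA W hj K N hN hK hHN hH3 ι v vbar hv hvbar hne κ hκ γ hrk hshaK
  -- (4) the Heegner datum of `P`; the Galois conjugate `P'` read through THE infinite place `w₀`
  obtain ⟨Dt, H, ιK, hPι⟩ := hP
  obtain ⟨w₀⟩ := (inferInstance : Nonempty (InfinitePlace K))
  haveI : IsGalois ℚ K := by
    haveI : Algebra.IsQuadraticExtension ℚ K := ⟨hK.1⟩
    infer_instance
  obtain ⟨σ, hσ⟩ := ComplexEmbedding.exists_comp_symm_eq_of_comp_eq (k := ℚ) w₀.embedding ιK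
    (by ext x; simp)
  set τ : K →+* K := ((σ.symm : K ≃ₐ[ℚ] K) : K →+* K) with hτdef
  set P' := WeierstrassCurve.Affine.Point.map τ.toRatAlgHom P with hP'def
  have hP' : WeierstrassCurve.Affine.Point.map w₀.embedding.toRatAlgHom P' =
      heegnerPointComplex Dt H := by
    rw [hP'def, WeierstrassCurve.Affine.Point.map_map]
    have hcomp : w₀.embedding.toRatAlgHom.comp τ.toRatAlgHom = ιK.toRatAlgHom := by
      apply AlgHom.ext
      intro x
      have := RingHom.congr_fun hσ x
      simpa [hτdef] using this
    rw [hcomp]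
    exact hPι
  -- (5) (LB-exist♯): the BDP element up to the constant `C ≠ 0` at `(Dt, v, κ, γ)`
  obtain ⟨ι', hι', ΩK, Ωp, Cst, L, hΩK, hC, hBDP⟩ := hE W hj K N Dt v κ γ hN hK hHN hsplit hv3 hκ
  -- (6) (LB-wan♯) along the structure map `toUnr : ℤ₃ → R₀` forces `𝓛(0) ≠ 0`
  obtain ⟨k, hk⟩ := hWan W hj ι' K N Dt v vbar κ γ hN hK hHN hsplit hι' hvbar hne hκ ΩK Ωp Cst L hΩK
    hC hBDP (Summit.BirchSwinnertonDyer.Rank1Residual.X11b.Halves.toUnr 3)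
    (Summit.BirchSwinnertonDyer.Rank1Residual.X11b.Halves.coe_toUnr 3)
  have hFmem : F ∈ AcSelmer.XAc.charIdeal (W.baseChange K) 3 κ vbar ∅ γ := by
    rw [hF]; exact Ideal.mem_span_singleton_self F
  obtain ⟨G, hG⟩ := Ideal.mem_span_singleton'.mp (hk F hFmem)
  have hL0 : PowerSeries.constantCoeff L ≠ 0 := by
    intro h0
    have h1 := congrArg (fun S : UnrSeries 3 ↦ ((PowerSeries.constantCoeff S : unrIntegers 3) : ℂ_[3])) hG
    simp only [map_mul, h0, mul_zero, PowerSeries.constantCoeff_C,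
      Summit.BirchSwinnertonDyer.Rank1Residual.X11b.CongruenceLimit.constantCoeff_map_apply, Subring.coe_mul,
      Subring.coe_pow, Subring.coe_zero,
      Summit.BirchSwinnertonDyer.Rank1Residual.X11b.Halves.coe_toUnr] at h1
    have h3' : ((3 : unrIntegers 3) : ℂ_[3]) = (3 : ℂ_[3]) := by norm_cast
    rw [h3'] at h1
    have h3 : algebraMap ℚ_[3] ℂ_[3] ((PowerSeries.constantCoeff F : ℤ_[3]) : ℚ_[3]) = 0 := by
      rcases mul_eq_zero.mp h1.symm with h | h
      · exact absurd (pow_eq_zero_iff'.mp h).1 three_ne_zero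
      · exact h
    rw [map_eq_zero_iff _ (algebraMap ℚ_[3] ℂ_[3]).injective] at h3
    exact hF0 (PadicInt.coe_eq_zero.mp h3)
  -- (7) (LB-bdp♯) at `P'`: `𝓛(0) = u · c⁻² · (…)² · (log_ω P')²`, `u ≠ 0` in `ℂ₃`
  obtain ⟨u, -, hu⟩ := hV W hj ι' K N Dt H w₀ ι v κ γ P' hN hK hHN hsplit hv3 hι' hκ hP' hv ΩK Ωp Cst L
    hΩK hC hBDP
  have hval := UnrSeries.eq_constantCoeff_of_hasValueAt_zero hu
  -- (8) a torsion `P` makes `P'` torsion and `log_ω P' = 0`, contradicting `𝓛(0) ≠ 0`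
  intro hPtor
  have hP'tor : IsOfFinAddOrder P' := by
    rw [hP'def]
    exact AddMonoidHom.isOfFinAddOrder _ hPtor
  have hlog : padicLogOmega W 3 ι P' = 0 := by
    unfold padicLogOmega
    rw [AcPConverseLinks.padicLogPoint_formalIndex_smul_eq_zero_of_isOfFinAddOrder W 3 ι hP'tor,
      zero_div]
  apply hL0
  rw [hlog, zero_pow two_ne_zero, mul_zero, map_zero, mul_zero] at hval
  exact_mod_cast hval.symm


/-! ## §4 The crux-B census, ported: crux B ⟸ (LB-exist♯) + (LB-wan♯) + (LB-bdp♯) + Poitou–Tate +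
six refereed facts -/

/-- **Crux B of S2b from the ♯ triple, modulo Poitou–Tate at imaginary quadratic fields and six refereed
facts** (port of p448851 `cruxB_of_bdpTriple_of_poitouTate_imaginaryQuadratic`): `3`-parity, modularity,
Hoffstein–Luo, Kato, Gross 1984, Gross–Zagier + Kolyvagin, Poitou–Tate at every imaginary quadratic field
(`hPT`, the registered `stub_textbookDualityImQuad`), (LB-exist♯), (LB-wan♯), (LB-bdp♯) ⟹
`AnalyticRankOneOfRankOneFiniteShaThree`: the ported plumbing with Link A :=
`threeAdicControlOfRankOne_of_poitouTate_imaginaryQuadratic hPT` (p448851), then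
`MordellShaFreeCutOfHeegnerNonTorsion.analyticRankOne_of_facts_of_heegnerNonTorsion` (p419697).
CONDITIONAL; credits nothing. [cite: MilneADT2006, Ch. I, Thm. 4.10(b) with Cor. 2.3]
[cite: GrossZagier1986, Thm. I.6.3 with V.§2]
[cite: CastellaGrossiLeeSkinner2022, §5.2 (proof of Thm. 5.2.1: the shape of a BDP-type p-converse)] -/
theorem cruxB_of_bdpTripleUpTo_of_poitouTate_imaginaryQuadratic
    (hpar : ∀ (W : WeierstrassCurve ℚ) [W.IsElliptic] (p : ℕ) [Fact p.Prime], p_parity W p)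
    (hmod : ModularForms.exists_isNewformOf) (hHL : HoffsteinLuo1997_exists_twist_L_one_ne_zero)
    (hKato : ∀ (W : WeierstrassCurve ℚ) [W.IsElliptic] (p : ℕ) [Fact p.Prime],
      kato_finite_of_L_one_ne_zero W p)
    (hHP : ∀ (W : WeierstrassCurve ℚ) (K : Type) [Field K] [NumberField K],
      exists_isHeegnerPoint W K)
    (hGZ : ∀ (W : WeierstrassCurve ℚ) (N : ℕ) [NeZero N] (K : Type) [Field K] [NumberField K],
      analyticRankEK_eq_one_iff_heegner_nonTorsion W N K)
    (hPT : ∀ (K : Type) [Field K] [NumberField K], IsImaginaryQuadratic K →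
      poitouTate_sum_localTatePairing_eq_zero K)
    (hE : ThreeAdicBDPElementExistsUpTo) (hWan : ThreeAdicWanDivisibilityUpTo)
    (hV : ThreeAdicBDPValueAtOneUpTo) : AnalyticRankOneOfRankOneFiniteShaThree :=
  MordellShaFreeCutOfHeegnerNonTorsion.analyticRankOne_of_facts_of_heegnerNonTorsion
    hpar hmod hHL hKato hHP hGZ
    (heegnerNonTorsion_of_linkA_of_bdpTripleUpTo hKato
      (threeAdicControlOfRankOne_of_poitouTate_imaginaryQuadratic hPT) hE hWan hV)

/-- **Crux B of S2b from the ♯ triple, modulo Poitou–Tate at every number field and six refereed facts**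
(port of p439803 `cruxB_of_bdpTriple_of_poitouTate`; the `∀ K` binder shape), by specialisation.
CONDITIONAL; credits nothing. [cite: MilneADT2006, Ch. I, Thm. 4.10(b) with Cor. 2.3]
[cite: GrossZagier1986, Thm. I.6.3 with V.§2] -/
theorem cruxB_of_bdpTripleUpTo_of_poitouTate
    (hpar : ∀ (W : WeierstrassCurve ℚ) [W.IsElliptic] (p : ℕ) [Fact p.Prime], p_parity W p)
    (hmod : ModularForms.exists_isNewformOf) (hHL : HoffsteinLuo1997_exists_twist_L_one_ne_zero)
    (hKato : ∀ (W : WeierstrassCurve ℚ) [W.IsElliptic] (p : ℕ) [Fact p.Prime],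
      kato_finite_of_L_one_ne_zero W p)
    (hHP : ∀ (W : WeierstrassCurve ℚ) (K : Type) [Field K] [NumberField K],
      exists_isHeegnerPoint W K)
    (hGZ : ∀ (W : WeierstrassCurve ℚ) (N : ℕ) [NeZero N] (K : Type) [Field K] [NumberField K],
      analyticRankEK_eq_one_iff_heegner_nonTorsion W N K)
    (hPT : ∀ (K : Type) [Field K] [NumberField K], poitouTate_sum_localTatePairing_eq_zero K)
    (hE : ThreeAdicBDPElementExistsUpTo) (hWan : ThreeAdicWanDivisibilityUpTo)
    (hV : ThreeAdicBDPValueAtOneUpTo) : AnalyticRankOneOfRankOneFiniteShaThree :=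
  cruxB_of_bdpTripleUpTo_of_poitouTate_imaginaryQuadratic hpar hmod hHL hKato hHP hGZ
    (fun K _ _ _ ↦ hPT K) hE hWan hV

end Summit.BirchSwinnertonDyer.BirchSwinnertonDyer.Theorems.MordellShaFreeCutThreeAdicBDPTripleUpTo

end
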